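import Summits.AtomisticToContinuum.HydrodynamicLimit.Theses.MourreKoopmanCharges
import Summits.AtomisticToContinuum.HydrodynamicLimit.Theorems.MourreKoopmanChargesStressStrongMixingStressFramework
import Literature.Analysis.FluidPDE.InfiniteHardSphereKoopman
import HarnessLib

/-!
# `StressStrongMixing` · line `birth`, stub B2 `stub_torusStressCovIdentification`:
# the infinite-volume side of the torus → `ℋ` identification is independent of the data `F`

Support file for the crux item stmt-AtomisticToContinuum-9584 (`StressStrongMixing`, route
`MourreKoopmanCharges` of `AtomisticToContinuum/HydrodynamicLimit`), serving the registered stub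
`stub_torusStressCovIdentification` (B2) of the skeleton `Cruxes/StressStrongMixing/Lines/birth.lean`:

  `∃ σ₀ > 0, ∀ σ ∈ (0, σ₀), ∀ θ > 0, ∀ z > 0, ∀ F : HardSphereFluctuationData σ,`
  `(Gibbs σ z θ⁻¹ ∧ density one ∧ flow =ᵐ an equilibrium Alexander flow ∧ Π ∈ 𝒱) →`
  `∀ Φ χ₁ χ₂ (continuous) ∀ s ≥ 0, (N+1) · Cov_{G_N}(Π(χ₁) ∘ Φ_{s(N+1)^{-1/3}}, Π(χ₂)) → ⟪U_s ξ_Π, ξ_Π⟫_ℋ · ∫ χ₁χ₂`,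

`Π(χ)(z) = (N+1)⁻¹ Σᵢ χ(xᵢ) vᵢ⁰vᵢ¹`, `G_N = localGibbsLaw σ 1 0 θ N (Φ N)` the canonical law of `N + 1` spheres of
diameter `σ (N+1)^{-1/3}` on the unit torus, `ξ_Π = [cellObs (v ↦ v⁰v¹)] ∈ ℋ_F`.

The stub is NOT closed here.  Its content — Spohn 1991 Part I (7.14)–(7.15): locality IN LAW of the infinite
hard-sphere dynamics at a fixed kinetic time together with the equivalence of the periodic canonical and the
infinite-volume Gibbs ensembles for TWO-TIME observables at fixed small packing — is not a theorem of the tree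
(nor, at fixed packing, of the printed literature; the dilute analogue is Bodineau–Gallagher–Saint-Raymond–Simonella,
CPAM 2023).  The closest tree facts are static and one-time: the named fact
`Georgii1995_hardSphereCanonicalLocalLimit` (local limit of the canonical torus laws along subsequences, window
laws of bounded events, unit diameter) and the proved contact-scale limit of the canonical correlation functions
(`HardSphereCanonicalKSLimit`).

What this file proves is the honest REDUCTION of the universally quantified stub ("for EVERY admissible `F`") to
its existential core ("for SOME admissible `F`", which is what (7.14)–(7.15) asserts of THE Gibbs state and THE
Alexander flow) plus two uniqueness inputs typed over tree carriers only, and thereby the audit that the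
right-hand side `⟪U_s ξ_Π, ξ_Π⟫_{ℋ_F}` cannot be moved by a degenerate-but-admissible `F`:

* `inner_koopman_fluct_self_eq_integral_cov` — `⟪U_s [a], [a]⟫_{ℋ_F} = ∫_{ℝ³} Cov_{F.μ}(a ∘ F.flow s, a ∘ τ_x) dx`
  for `a ∈ 𝒱_F`: the matrix element is a function of the STATE and of the a.e.-CLASS of the time-`s` flow map
  alone (the observable space `𝒱_F`, once it contains `a`, is immaterial);
* `inner_koopman_fluct_self_congr` — hence two data with the same state whose time-`s` maps agree a.e. have the
  same matrix element (flows differing from Alexander's on a null set change nothing);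
* `inner_koopman_self_eq_neg` — `⟪U_s ψ, ψ⟫ = ⟪U_{-s} ψ, ψ⟫` (the real Koopman group is orthogonal), so the time
  orientation of the torus pairing `Π(χ₁) ∘ Φ_τ` against `Π(χ₂)` at time `0` cannot be mis-matched;
* `isTranslationInvariant_μ`, `density_eq_one_of_integral_cellCharge_zero` — the data's state is translation
  invariant, and the stub's real-valued density clause `∫ cellCharge 0 dμ = 1` is the point-process density
  `PointProcess.density μ = 1` (mean number of centres in `[0,1)³`; after the blow-up `x ↦ (N+1)^{1/3} x` the
  torus system has exactly this density and diameter `σ`);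
* `stressAutocorrelation_eq_of_unique` — given Alexander's uniqueness theorem BY NAME
  (`InfiniteHardSphereFlow.unique (d := Fin 3)`, Alexander 1976 Cor. 5.4) and the uniqueness of the
  translation-invariant DLR state of density one at small reduced diameter (Ruelle 1969 Thm 4.2.3 with Georgii 1995
  Thm 3.4 / Remark 3.7: the tree's named fact `HardSphereGibbsLowDensityUniqueness` in its scaling-covariant form,
  threshold `ρ₀(σ) = ρ₀(1) σ⁻³ > 1`; an a-priori bound `z ≤ ρ/(1 - ρ·(4π/3)σ³)` from the first Kirkwood–Salsburg
  equation puts every density-one state inside Ruelle's disc of radius `(e (4π/3) σ³)⁻¹` once `σ < 0.4`), any two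
  admissible data at the same `(σ, θ)` — whatever their activities, observable spaces and flow representatives —
  have the same stress autocorrelation `⟪U_s ξ_Π, ξ_Π⟫`;
* `torusStressCovIdentification_of` — the stub follows from these two uniqueness inputs and its existential core.

References: H. Spohn, *Large Scale Dynamics of Interacting Particles* (1991), Part I §7.1 (7.4)–(7.7),
(7.14)–(7.15); R. Alexander, Comm. Math. Phys. 49 (1976), Thm 5.2, Cor. 5.4; D. Ruelle, *Statistical Mechanics*
(1969), Thm 4.2.3; H.-O. Georgii, Probab. Theory Relat. Fields 99 (1994/95), Thm 3.3–3.4, Remarks 3.6–3.7.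
-/

noncomputable section

open MeasureTheory ProbabilityTheory Filter Topology
open scoped InnerProductSpace ENNReal

namespace Summit.AtomisticToContinuum.HydrodynamicLimit.Theorems.MourreKoopmanChargesStressStrongMixing

open Literature.MathematicalPhysics.KineticTheory Literature.Analysis.FluidPDE
open Literature.Analysis.FunctionSpaces (PointConfig)

/-! ### The state of a fluctuation data: translation invariance and density -/

/-- **The state of hard-sphere fluctuation data is translation invariant** (the field
`measurePreserving_shift` of the structure, read as `IsTranslationInvariant`: the spatial shift `τ_a` IS the
translation by `(a, 0)` of marked configurations). [folklore] -/
theorem isTranslationInvariant_μ {σ : ℝ} (F : HardSphereFluctuationData σ) : IsTranslationInvariant F.μ :=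
  fun a => (F.measurePreserving_shift a).map_eq

/-- **The real density clause is the point-process density clause**: for a law carried by hard-sphere
configurations, `∫ cellCharge 0 dμ = 1` forces `PointProcess.density μ = 1` (the integral is the real part of
the density, `integral_cellCharge_zero_eq_toReal_density`, and `x.toReal = 1 ↔ x = 1` in `ℝ≥0∞`). [folklore] -/
theorem density_eq_one_of_integral_cellCharge_zero {σ : ℝ} (hσ : 0 < σ) {μ : Measure MarkedConfig}
    (hcore : ∀ᵐ ω ∂μ, IsHardCore σ ω) (h : ∫ ω, cellCharge 0 ω ∂μ = 1) :
    PointProcess.density μ = 1 := by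
  rw [integral_cellCharge_zero_eq_toReal_density hσ hcore] at h
  exact (ENNReal.toReal_eq_one_iff _).1 h

/-- Under the stub's hypotheses the state is carried by hard-sphere configurations of diameter `σ` (the
equilibrium flow is a.e. defined in the Gibbs state, and its good set consists of hard-sphere configurations).
[folklore] -/
theorem isHardCore_ae_of_gibbs {σ θ z : ℝ} (hθ : 0 < θ) (hz : 0 < z) {μ : Measure MarkedConfig}
    (hμ : IsHardSphereGibbs σ z θ⁻¹ (0 : V3) μ) {Ψ : InfiniteHardSphereFlow (Fin 3) σ}
    (hΨ : Ψ.IsEquilibriumFlow) : ∀ᵐ ω ∂μ, IsHardCore σ ω :=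
  Ψ.isHardCore_ae (hΨ.isAEDefined hz (inv_pos.2 hθ) hμ)

/-! ### The matrix element `⟪U_s [a], [a]⟫` is a function of the state and of the a.e.-class of the flow -/

/-- **`⟪U_s [a], [a]⟫_{ℋ_F} = ∫_{ℝ³} Cov_{F.μ}(a ∘ φ_s, a ∘ τ_x) dx`** for a local observable `a ∈ 𝒱_F`
(`U_s [a] = [a ∘ φ_s]`, `koopman_fluct`, and `⟪[b], [a]⟫ = ∫ Cov(b, a ∘ τ_x) dx`, `inner_fluct_fluct`;
Spohn 1991 Part I (7.14)–(7.15)).  In particular the value does not depend on the observable space `𝒱_F`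
beyond the membership `a ∈ 𝒱_F`. [folklore] -/
theorem inner_koopman_fluct_self_eq_integral_cov {σ : ℝ} (F : HardSphereFluctuationData σ)
    {a : MarkedConfig → ℝ} (ha : a ∈ F.localObs) (s : ℝ) :
    ⟪F.koopman s (F.fluct a), F.fluct a⟫_ℝ = ∫ x, cov[a ∘ F.flow s, a ∘ spatialShift x; F.μ] := by
  rw [F.koopman_fluct s ha, FluctuationStructure.inner_fluct_fluct (F.comp_flow_mem s ha) ha]
  rfl

/-- **Two data with the same state whose time-`s` flow maps agree almost everywhere have the same matrix
element `⟪U_s [a], [a]⟫`** (for `a` in both observable spaces): a flow differing from Alexander's on a null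
set, or a different (larger, smaller, exotic) observable space, cannot change the stub's right-hand side. [folklore] -/
theorem inner_koopman_fluct_self_congr {σ : ℝ} (F₁ F₂ : HardSphereFluctuationData σ) (hμ : F₁.μ = F₂.μ)
    {a : MarkedConfig → ℝ} (h₁ : a ∈ F₁.localObs) (h₂ : a ∈ F₂.localObs) {s : ℝ}
    (hflow : F₁.flow s =ᵐ[F₁.μ] F₂.flow s) :
    ⟪F₁.koopman s (F₁.fluct a), F₁.fluct a⟫_ℝ = ⟪F₂.koopman s (F₂.fluct a), F₂.fluct a⟫_ℝ := by
  rw [inner_koopman_fluct_self_eq_integral_cov F₁ h₁, inner_koopman_fluct_self_eq_integral_cov F₂ h₂, ← hμ]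
  refine integral_congr_ae (Filter.Eventually.of_forall fun x => ?_)
  exact covariance_congr_ae (hflow.fun_comp a) Filter.EventuallyEq.rfl

/-- **Time orientation is immaterial**: `⟪U_s ψ, ψ⟫ = ⟪U_{-s} ψ, ψ⟫` for the (orthogonal) Koopman group on the
real Hilbert space `ℋ_F` (`⟪U_s ψ, ψ⟫ = ⟪U_{-s} U_s ψ, U_{-s} ψ⟫ = ⟪ψ, U_{-s} ψ⟫`), so pairing the time-evolved
torus field with the time-zero one, or conversely, has the same limit. [folklore] -/
theorem inner_koopman_self_eq_neg {σ : ℝ} (F : HardSphereFluctuationData σ) (s : ℝ)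
    (ψ : HardSphereFluctuationSpace F) :
    ⟪F.koopman s ψ, ψ⟫_ℝ = ⟪F.koopman (-s) ψ, ψ⟫_ℝ := by
  rw [← F.inner_koopman_koopman (-s) (F.koopman s ψ) ψ, ← F.koopman_add_apply, neg_add_cancel,
    F.koopman_zero_apply, real_inner_comm]

/-! ### Uniqueness inputs ⇒ the stress autocorrelation does not depend on the admissible data -/

/-- **Under Alexander's uniqueness theorem the flows of two admissible data agree almost everywhere.**  If
`F.flow` and `F'.flow` are a.e. equal to equilibrium flows `Ψ`, `Ψ'` under a common Gibbs state `μ = F.μ = F'.μ`,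
then `F.flow s =ᵐ[μ] F'.flow s` for every `s` (`InfiniteHardSphereFlow.unique`, Alexander 1976 Cor. 5.4, BY NAME).
[folklore] -/
theorem flow_ae_eq_of_unique {σ θ z : ℝ} (hU : InfiniteHardSphereFlow.unique (d := Fin 3)) (hσ : 0 < σ)
    (hθ : 0 < θ) (hz : 0 < z) (F F' : HardSphereFluctuationData σ) (hμ : F.μ = F'.μ)
    (hG : IsHardSphereGibbs σ z θ⁻¹ (0 : V3) F.μ)
    {Ψ : InfiniteHardSphereFlow (Fin 3) σ} (hΨ : Ψ.IsEquilibriumFlow) (hflow : ∀ t : ℝ, F.flow t =ᵐ[F.μ] Ψ.flow t)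
    {Ψ' : InfiniteHardSphereFlow (Fin 3) σ} (hΨ' : Ψ'.IsEquilibriumFlow)
    (hflow' : ∀ t : ℝ, F'.flow t =ᵐ[F'.μ] Ψ'.flow t) (s : ℝ) :
    F.flow s =ᵐ[F.μ] F'.flow s := by
  have hu : ∀ᵐ ω ∂F.μ, ∀ t, Ψ.flow t ω = Ψ'.flow t ω := hU hσ Ψ Ψ' hΨ hΨ' z θ⁻¹ hz (inv_pos.2 hθ) F.μ hG
  have h3 : F'.flow s =ᵐ[F.μ] Ψ'.flow s := by
    rw [hμ]
    exact hflow' s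
  filter_upwards [hflow s, hu, h3] with ω h1 h2 h3
  rw [h1, h2 s, h3]

/-- **The stress autocorrelation `⟪U_s ξ_Π, ξ_Π⟫_{ℋ_F}` is the same for all admissible data at `(σ, θ)`.**
Inputs: (U) Alexander's uniqueness theorem `InfiniteHardSphereFlow.unique (d := Fin 3)` BY NAME; (U1) for
`σ < σ₁` two translation-invariant DLR states of the hard-sphere gas of diameter `σ` at the same inverse
temperature, both of density one, coincide whatever their activities (Ruelle 1969 Thm 4.2.3 + Georgii 1995
Thm 3.4 / Remark 3.7 = the named fact `HardSphereGibbsLowDensityUniqueness` at diameter `σ` with threshold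
`ρ₀(σ) = ρ₀(1) σ⁻³ > 1`, its scaling-covariant form, not recorded in the tree).  Then for any two data `F`, `F'`
satisfying the stub's hypotheses at `(σ, θ)` with activities `z`, `z'`: `F.μ = F'.μ` (U1, via
`isTranslationInvariant_μ` and `density_eq_one_of_integral_cellCharge_zero`), `F.flow s =ᵐ F'.flow s`
(`flow_ae_eq_of_unique`), hence equal matrix elements (`inner_koopman_fluct_self_congr`). [folklore] -/
theorem stressAutocorrelation_eq_of_unique {σ σ₁ θ z z' : ℝ} (hU : InfiniteHardSphereFlow.unique (d := Fin 3))
    (hU1 : ∀ σ : ℝ, 0 < σ → σ < σ₁ → ∀ β : ℝ, 0 < β → ∀ (z z' : ℝ) (μ μ' : Measure MarkedConfig),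
      0 < z → 0 < z' → IsHardSphereGibbs σ z β (0 : V3) μ → IsHardSphereGibbs σ z' β (0 : V3) μ' →
      IsTranslationInvariant μ → IsTranslationInvariant μ' →
      PointProcess.density μ = 1 → PointProcess.density μ' = 1 → μ = μ')
    (hσ : 0 < σ) (hσ₁ : σ < σ₁) (hθ : 0 < θ) (hz : 0 < z) (hz' : 0 < z')
    (F F' : HardSphereFluctuationData σ)
    (hF : IsHardSphereGibbs σ z θ⁻¹ (0 : V3) F.μ ∧ (∫ ω, cellCharge 0 ω ∂F.μ = 1) ∧
      (∃ Φ : InfiniteHardSphereFlow (Fin 3) σ, Φ.IsEquilibriumFlow ∧ ∀ t : ℝ, F.flow t =ᵐ[F.μ] Φ.flow t) ∧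
      cellObs (fun v : V3 => v 0 * v 1) ∈ F.localObs)
    (hF' : IsHardSphereGibbs σ z' θ⁻¹ (0 : V3) F'.μ ∧ (∫ ω, cellCharge 0 ω ∂F'.μ = 1) ∧
      (∃ Φ : InfiniteHardSphereFlow (Fin 3) σ, Φ.IsEquilibriumFlow ∧ ∀ t : ℝ, F'.flow t =ᵐ[F'.μ] Φ.flow t) ∧
      cellObs (fun v : V3 => v 0 * v 1) ∈ F'.localObs)
    (s : ℝ) :
    ⟪F.koopman s (F.fluct (cellObs fun v : V3 => v 0 * v 1)), F.fluct (cellObs fun v : V3 => v 0 * v 1)⟫_ℝ =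
      ⟪F'.koopman s (F'.fluct (cellObs fun v : V3 => v 0 * v 1)),
        F'.fluct (cellObs fun v : V3 => v 0 * v 1)⟫_ℝ := by
  obtain ⟨hG, hρ, ⟨Ψ, hΨ, hflow⟩, hPi⟩ := hF
  obtain ⟨hG', hρ', ⟨Ψ', hΨ', hflow'⟩, hPi'⟩ := hF'
  have hβ : 0 < θ⁻¹ := inv_pos.2 hθ
  have hd : PointProcess.density F.μ = 1 :=
    density_eq_one_of_integral_cellCharge_zero hσ (isHardCore_ae_of_gibbs hθ hz hG hΨ) hρ
  have hd' : PointProcess.density F'.μ = 1 :=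
    density_eq_one_of_integral_cellCharge_zero hσ (isHardCore_ae_of_gibbs hθ hz' hG' hΨ') hρ'
  have hμ : F.μ = F'.μ := hU1 σ hσ hσ₁ θ⁻¹ hβ z z' F.μ F'.μ hz hz' hG hG'
    (isTranslationInvariant_μ F) (isTranslationInvariant_μ F') hd hd'
  exact inner_koopman_fluct_self_congr F F' hμ hPi hPi'
    (flow_ae_eq_of_unique hU hσ hθ hz F F' hμ hG hΨ hflow hΨ' hflow' s)

/-! ### The reduction of stub B2 to its existential core and the two uniqueness inputs -/

/-- **Stub B2 from its infinite-volume inputs.**  (U) Alexander's uniqueness theorem BY NAME,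
`InfiniteHardSphereFlow.unique (d := Fin 3)`; (U1) uniqueness of the translation-invariant DLR state of the
hard-sphere gas of small reduced diameter `σ` at prescribed inverse temperature and density one (Ruelle 1969
Thm 4.2.3 / Georgii 1995 Thm 3.4, Remark 3.7; the scaling-covariant form of `HardSphereGibbsLowDensityUniqueness`);
(B2∃) the EXISTENTIAL CORE of the stub — for small `σ` and every `θ` there is ONE density-one framework `F⋆`
(DLR Gibbs at some activity, flow a.e. Alexander's, shear stress local) for which the torus two-time stress
covariances times `N + 1` converge to `⟪U_s ξ_Π, ξ_Π⟫_{ℋ_{F⋆}} · ∫ χ₁χ₂` for every flow family, continuous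
`χ₁, χ₂` and `s ≥ 0`: Spohn 1991 Part I (7.14)–(7.15) = locality in law of Alexander's dynamics at fixed kinetic
time + equivalence of the periodic canonical and the infinite-volume ensembles for two-time observables at fixed
small packing (NOT in the tree; dilute analogue: BGSS, CPAM 2023).  Then the stub holds with `σ₀ := min σ₁ σ₂`:
for an arbitrary admissible `F` at `(σ, θ)` the right-hand side equals that of `F⋆`
(`stressAutocorrelation_eq_of_unique`), while the torus side does not mention `F`. [folklore] -/
theorem torusStressCovIdentification_of :
    InfiniteHardSphereFlow.unique (d := Fin 3) →
    (∃ σ₁ : ℝ, 0 < σ₁ ∧ ∀ σ : ℝ, 0 < σ → σ < σ₁ → ∀ β : ℝ, 0 < β →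
      ∀ (z z' : ℝ) (μ μ' : Measure MarkedConfig), 0 < z → 0 < z' →
        IsHardSphereGibbs σ z β (0 : V3) μ → IsHardSphereGibbs σ z' β (0 : V3) μ' →
        IsTranslationInvariant μ → IsTranslationInvariant μ' →
        PointProcess.density μ = 1 → PointProcess.density μ' = 1 → μ = μ') →
    (∃ σ₂ : ℝ, 0 < σ₂ ∧ ∀ σ : ℝ, 0 < σ → σ < σ₂ → ∀ θ : ℝ, 0 < θ →
      ∃ z : ℝ, 0 < z ∧ ∃ F : HardSphereFluctuationData σ,
        (IsHardSphereGibbs σ z θ⁻¹ (0 : V3) F.μ ∧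
          (∫ ω, cellCharge 0 ω ∂F.μ = 1) ∧
          (∃ Φ : InfiniteHardSphereFlow (Fin 3) σ, Φ.IsEquilibriumFlow ∧ ∀ t : ℝ, F.flow t =ᵐ[F.μ] Φ.flow t) ∧
          cellObs (fun v : V3 => v 0 * v 1) ∈ F.localObs) ∧
        ∀ Φ : (N : ℕ) → HardSphereFlow (Torus.geometry (Fin 3)) (hsDiameter σ N) (N + 1),
        ∀ χ₁ χ₂ : T3 → ℝ, Continuous χ₁ → Continuous χ₂ → ∀ s : ℝ, 0 ≤ s →
          Tendsto (fun N : ℕ => ((N : ℝ) + 1) *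
              cov[fun z => ∫ y, χ₁ y.1 * (y.2 0 * y.2 1)
                    ∂(empiricalMeasure ((Φ N).flow (s * ((N : ℝ) + 1) ^ (-(1 / 3 : ℝ))) z)),
                  fun z => ∫ y, χ₂ y.1 * (y.2 0 * y.2 1) ∂(empiricalMeasure z);
                localGibbsLaw σ (fun _ => 1) (fun _ => 0) (fun _ => θ) N (Φ N)]) atTop
            (𝓝 (⟪F.koopman s (F.fluct (cellObs fun v : V3 => v 0 * v 1)),
                  F.fluct (cellObs fun v : V3 => v 0 * v 1)⟫_ℝ * ∫ x, χ₁ x * χ₂ x))) →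
    ∃ σ₀ : ℝ, 0 < σ₀ ∧ ∀ σ : ℝ, 0 < σ → σ < σ₀ → ∀ θ : ℝ, 0 < θ → ∀ z : ℝ, 0 < z →
      ∀ F : HardSphereFluctuationData σ,
        (IsHardSphereGibbs σ z θ⁻¹ (0 : V3) F.μ ∧
          (∫ ω, cellCharge 0 ω ∂F.μ = 1) ∧
          (∃ Φ : InfiniteHardSphereFlow (Fin 3) σ, Φ.IsEquilibriumFlow ∧ ∀ t : ℝ, F.flow t =ᵐ[F.μ] Φ.flow t) ∧
          cellObs (fun v : V3 => v 0 * v 1) ∈ F.localObs) →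
      ∀ Φ : (N : ℕ) → HardSphereFlow (Torus.geometry (Fin 3)) (hsDiameter σ N) (N + 1),
      ∀ χ₁ χ₂ : T3 → ℝ, Continuous χ₁ → Continuous χ₂ → ∀ s : ℝ, 0 ≤ s →
        Tendsto (fun N : ℕ => ((N : ℝ) + 1) *
            cov[fun z => ∫ y, χ₁ y.1 * (y.2 0 * y.2 1)
                  ∂(empiricalMeasure ((Φ N).flow (s * ((N : ℝ) + 1) ^ (-(1 / 3 : ℝ))) z)),
                fun z => ∫ y, χ₂ y.1 * (y.2 0 * y.2 1) ∂(empiricalMeasure z);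
              localGibbsLaw σ (fun _ => 1) (fun _ => 0) (fun _ => θ) N (Φ N)]) atTop
          (𝓝 (⟪F.koopman s (F.fluct (cellObs fun v : V3 => v 0 * v 1)),
                F.fluct (cellObs fun v : V3 => v 0 * v 1)⟫_ℝ * ∫ x, χ₁ x * χ₂ x)) := by
  intro hU hU1 hB
  obtain ⟨σ₁, hσ₁, H₁⟩ := hU1
  obtain ⟨σ₂, hσ₂, H₂⟩ := hB
  refine ⟨min σ₁ σ₂, lt_min hσ₁ hσ₂, ?_⟩
  intro σ hσ hσlt θ hθ z hz F hF Φ χ₁ χ₂ hχ₁ hχ₂ s hs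
  have h₁ : σ < σ₁ := lt_of_lt_of_le hσlt (min_le_left _ _)
  have h₂ : σ < σ₂ := lt_of_lt_of_le hσlt (min_le_right _ _)
  obtain ⟨z', hz', F', hF', H'⟩ := H₂ σ hσ h₂ θ hθ
  rw [stressAutocorrelation_eq_of_unique hU H₁ hσ h₁ hθ hz hz' F F' hF hF' s]
  exact H' Φ χ₁ χ₂ hχ₁ hχ₂ s hs

end Summit.AtomisticToContinuum.HydrodynamicLimit.Theorems.MourreKoopmanChargesStressStrongMixing

end
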